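import Summits.Ventures.CertifiedManyBodySolver.Downfold.EmeryFermiFillingNdNiO2Subs
import Summits.Ventures.CertifiedManyBodySolver.Downfold.EmeryBoxesKSlicesT
import Summits.Ventures.CertifiedManyBodySolver.Downfold.BoxesNdNiO2E
import HarnessLib

/-!
# NdNiO₂ (#21): the typed 3BE objects ⇒ a CERTIFIED window for the σ-model Fermi-surface `t′/t` at the material fillings —
# and a certified MODEL-FORM GAP of at least `1/8` against the object-E row of record `t′/t_eff ∈ [−0.46, −0.36]`

Venture CertifiedManyBodySolver, cell `pub/hubbard-downfold` (stage S1, HUMAN RULINGS D-0096/D-0098: the three-band → one-band reduction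
error is carried explicitly; director D-0154 block (C) COVERAGE «downfold certified error bars for La₂CuO₄ and two more materials» — THIS is
material (iii) NdNiO₂), seat hubbard-cov-ndnio2-unc-2 (object-E uncertainty-ladder lane, ruling R-ma) on the kernel device of
hubbard-downfold-mod-4 g19 (`EmeryFermiFilling*`, cited BY NAME; mod-4's own material files are `EmeryFermiFillingLa214(Subs)`,
`EmeryFermiFillingHg1201Subs`, `EmeryFermiFillingLSCOSubs` …); namespace `Summit.Ventures.CertifiedManyBodySolver.Downfold.Emery`. Everything here is PROVED; every numerical
fact is decided by the kernel in `EmeryFermiFillingNdNiO2Subs` (12 sub-boxes, `decide +kernel`).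

THE STATEMENTS. For EVERY parameter vector of the #21 NdNiO₂ three-band one-body rows (`EmeryBoxesKSlicesD`: t_pd ∈ [1.17, 1.37],
t_pp ∈ [0.56, 0.68], t_pp′ ∈ [0.121, 0.123] eV; router/EMERY-LINE-ROWS.tsv row «NdNiO2 (M21; La-proxy)» with the R-al fold) and EVERY Fermi
energy `ε` at which the σ-model antibonding band holds the electrons of ANY object-E column of box #20 — per-spin filling
`abFilling(ε) ∈ [0.343, 0.477]`, the hull of the density rows n ∈ [0.686, 0.954] of `boxNdNiO2E_M21` / `boxNdSrNiO2E_M22` / `_M59` / `_M60`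
— the EXACT `t–t′` shape of the three-band Fermi surface (`EmeryFermiSurfaceShape`: every constant-energy contour of the σ model IS a
`t–t′` contour, `t″ = 0`) has
* on the DFT-level source row Δ_pd ∈ [3.97, 5.0] (`ndNiO2YK26Emery_DeltaKS`; typed object `emeryBoxNdNiO2YK26Src`):
  **`t′/t ∈ [-0.2344, -0.1748]`**, ε ∈ [0.68, 1.54] eV above ε_d (`ndNiO2KSBox_fsRatio_window`, `emeryBoxNdNiO2YK26Src_fsRatio_window`);
* on the bare-electron image Δ_pd ∈ [4.6, 6.24] (`ndNiO2YK26Emery_Delta`; the U-slice of record `emeryBoxNdNiO2YK26` and, by the typed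
  `Refines` chain, `emeryBoxNdNiO2Dxy459YK26` ⊑ it and `emeryBoxNdNiO2Dxy45YK26` ⊑ that): **`t′/t ∈ [-0.2194, -0.1532]`**;
* on the hull Δ_pd ∈ [3.97, 6.24]: `t′/t ∈ [-0.2344, -0.1532]`, ε ∈ [0.56, 1.54] (`ndNiO2HullBox_fsRatio_window`).

READING 1 — MODEL-FORM GAP (certified; numbers, not adjectives). Box #20's object-E row of record is `t′/t_eff ∈ [−0.46, −0.36]`
(`router/BOXES/NdNiO2.md` §DFT-1b v1.1 / §OF-RECORD v1.1, re-printed [−0.458, −0.357] in §R-ac FOLD v1: `t–t′`-only least-squares refits of the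
k_z-averaged one-band Wannier (W) and DFT (D) bands near E_F; typed `ndNiO2E_M21_tp` = [−23/50, −9/25], identical in all four columns). The σ
three-band model CANNOT REACH IT ANYWHERE: `t′/t ≥ -0.2344 ≥ −9/25 + 1/8` at every box point and every family filling
(`ndNiO2HullBox_fsRatio_gap_objectE`, `…_not_objectE`), and as a two-box word BY NAME: for every member of the 3BE source object and every member
`q` of `boxNdNiO2E_M21` (resp. `boxNdSrNiO2E_M22` / `_M59` / `_M60`), at the σ-model Fermi energy carrying `q`'s own density,
`(t′/t)_σ ≥ q.tp + 1/8` (`emeryBoxNdNiO2YK26Src_fsRatio_gap_boxNdNiO2E_M21` …). INFL-3to1-B(t′/t of E, NdNiO₂, FS level) ≥ 0.1256 in |t′/t| BY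
THEOREM — the kernel form of mod-4's float note §REDUCTION-B v0.2 (2) («the dpσ block misses ≈ 0.2 of t′_eff (FS) by construction»; there
attributed, at SCREENING grade, to an axial / interstitial-s channel of Pavarini type with r ≈ 0.2 — NOT asserted here). Across block (C): La₂CuO₄ σ
window [−0.2955, −0.1653] OVERLAPS its E row [−0.30, −0.20] (`EmeryFermiFillingLa214`); Hg-1201 (mod-4 g19, P = 0 box v1.14): σ window [−0.3717, −0.2486] vs E row [−0.57, −0.46] ⇒ gap ≥ 0.088; NdNiO₂ gap ≥ 0.1256 (this file) —
the largest of the three.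

READING 2 — WHERE THE σ IMAGE SITS. `|t′/t| < 1/4` on the whole hull (`ndNiO2HullBox_abs_fsRatio_lt_quarter`): the σ-model Fermi surface of
the nickelate 3BE rows lies INSIDE hubbard-fast's one-band domain 𝒟 (|t′/t| ≤ 0.3) — where object M's band-level row [−0.291, −0.190] also
sits — while object E is outside 𝒟 (§OF-RECORD v1.1 containment reading). The filling dependence is certified-small: the family band
[0.343, 0.477] and the parent-only band [0.426, 0.477] give windows that differ by ≤ 2·10⁻⁴ (generator tables cert_ndnio2_F/P.json), so ONE
band serves all four columns.

WHAT THIS IS NOT: not a statement that NdNiO₂'s parameters ARE in the rows (SCREENING / EXTRAPOLATED-grade provenance, CLASS-PROXY U pair;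
the theorems certify the REDUCTION STEP of the σ model only); not the interaction (`U`) reduction; object E is a WINDOWED refit (w = 0.3 / 0.5 eV)
while `fsRatio` is the exact contour ratio at ε_F — the certified window covers every ε whose filling lies in the family band (an energy range
0.4–0.6 eV wide per box point, table of `EmeryFermiFillingNdNiO2Subs`), so the gap is insensitive to that convention at the stated 4-decimal
level only in the sense certified here; no `T_c` / phase sentence; items of route CovNdNiO2M21/M22 untouched. Sources: [HybertsenSchluterChristensen1989, Eq. (1)];
[AndersenEtAl1995, §6]; [PavariniEtAl2001, Eq. (1)].
-/

noncomputable section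

namespace Summit.Ventures.CertifiedManyBodySolver.Downfold.Emery

open Real Set
open Summit.Ventures.CertifiedManyBodySolver.Downfold

/-! ## §1 Raw windows (Fermi-energy bracket ∧ `t′/t` window): hull, DFT-level source row, bare-electron image -/

/-- **NdNiO₂ 3BE rows ⇒ σ-model `t′/t` window on the Δ hull (raw coordinates).** For Δ_pd ∈ [3.97, 6.24], t_pd ∈ [1.17, 1.37], t_pp ∈ [0.56, 0.68], t_pp′ ∈ [0.121, 0.123] and every Fermi energy with per-spin filling in [0.343, 0.477]: `ε ∈ [0.56, 1.54]` (eV above ε_d) and `t′/t ∈ [-0.2344, -0.1532]`. [folklore] -/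
theorem ndNiO2HullBox_fsRatio_window {Δ tpd tpp c ε : ℝ} (hΔ : Δ ∈ Set.Icc (397 / 100 : ℝ) (156 / 25 : ℝ))
    (ha : tpd ∈ Set.Icc (117 / 100 : ℝ) (137 / 100 : ℝ)) (hb : tpp ∈ Set.Icc (14 / 25 : ℝ) (17 / 25 : ℝ))
    (hc : c ∈ Set.Icc (121 / 1000 : ℝ) (123 / 1000 : ℝ))
    (hν : abFilling Δ tpd tpp c ε ∈ Set.Icc (343 / 1000 : ℝ) (477 / 1000 : ℝ)) :
    ε ∈ Set.Icc (14 / 25 : ℝ) (77 / 50 : ℝ) ∧ fsRatio Δ tpd tpp c ε ∈ Set.Icc (-(293 / 1250 : ℝ)) (-(383 / 2500 : ℝ)) := by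
  have hΔ' := hΔ
  rcases le_total Δ (5 : ℝ) with hx | hx
  · have hΔ' : Δ ∈ Set.Icc (397 / 100 : ℝ) (5 : ℝ) := ⟨hΔ'.1, hx⟩
    rcases le_total Δ (857 / 200 : ℝ) with hx | hx
    · have hΔ' : Δ ∈ Set.Icc (397 / 100 : ℝ) (857 / 200 : ℝ) := ⟨hΔ'.1, hx⟩
      rcases le_total tpd (127 / 100 : ℝ) with hx | hx
      · have h := ndNiO2Sub_0_0 hΔ' ⟨ha.1, hx⟩ hb hc hν
        exact ⟨⟨le_trans (by norm_num) h.1.1, h.1.2.trans (by norm_num)⟩, ⟨le_trans (by norm_num) h.2.1, h.2.2.trans (by norm_num)⟩⟩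
      · have h := ndNiO2Sub_0_1 hΔ' ⟨hx, ha.2⟩ hb hc hν
        exact ⟨⟨le_trans (by norm_num) h.1.1, h.1.2.trans (by norm_num)⟩, ⟨le_trans (by norm_num) h.2.1, h.2.2.trans (by norm_num)⟩⟩
    · have hΔ' : Δ ∈ Set.Icc (857 / 200 : ℝ) (5 : ℝ) := ⟨hx, hΔ'.2⟩
      rcases le_total Δ (23 / 5 : ℝ) with hx | hx
      · have hΔ' : Δ ∈ Set.Icc (857 / 200 : ℝ) (23 / 5 : ℝ) := ⟨hΔ'.1, hx⟩
        rcases le_total tpd (127 / 100 : ℝ) with hx | hx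
        · have h := ndNiO2Sub_1_0 hΔ' ⟨ha.1, hx⟩ hb hc hν
          exact ⟨⟨le_trans (by norm_num) h.1.1, h.1.2.trans (by norm_num)⟩, ⟨le_trans (by norm_num) h.2.1, h.2.2.trans (by norm_num)⟩⟩
        · have h := ndNiO2Sub_1_1 hΔ' ⟨hx, ha.2⟩ hb hc hν
          exact ⟨⟨le_trans (by norm_num) h.1.1, h.1.2.trans (by norm_num)⟩, ⟨le_trans (by norm_num) h.2.1, h.2.2.trans (by norm_num)⟩⟩
      · have hΔ' : Δ ∈ Set.Icc (23 / 5 : ℝ) (5 : ℝ) := ⟨hx, hΔ'.2⟩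
        rcases le_total tpd (127 / 100 : ℝ) with hx | hx
        · have h := ndNiO2Sub_2_0 hΔ' ⟨ha.1, hx⟩ hb hc hν
          exact ⟨⟨le_trans (by norm_num) h.1.1, h.1.2.trans (by norm_num)⟩, ⟨le_trans (by norm_num) h.2.1, h.2.2.trans (by norm_num)⟩⟩
        · have h := ndNiO2Sub_2_1 hΔ' ⟨hx, ha.2⟩ hb hc hν
          exact ⟨⟨le_trans (by norm_num) h.1.1, h.1.2.trans (by norm_num)⟩, ⟨le_trans (by norm_num) h.2.1, h.2.2.trans (by norm_num)⟩⟩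
  · have hΔ' : Δ ∈ Set.Icc (5 : ℝ) (156 / 25 : ℝ) := ⟨hx, hΔ'.2⟩
    rcases le_total Δ (541 / 100 : ℝ) with hx | hx
    · have hΔ' : Δ ∈ Set.Icc (5 : ℝ) (541 / 100 : ℝ) := ⟨hΔ'.1, hx⟩
      rcases le_total tpd (127 / 100 : ℝ) with hx | hx
      · have h := ndNiO2Sub_3_0 hΔ' ⟨ha.1, hx⟩ hb hc hν
        exact ⟨⟨le_trans (by norm_num) h.1.1, h.1.2.trans (by norm_num)⟩, ⟨le_trans (by norm_num) h.2.1, h.2.2.trans (by norm_num)⟩⟩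
      · have h := ndNiO2Sub_3_1 hΔ' ⟨hx, ha.2⟩ hb hc hν
        exact ⟨⟨le_trans (by norm_num) h.1.1, h.1.2.trans (by norm_num)⟩, ⟨le_trans (by norm_num) h.2.1, h.2.2.trans (by norm_num)⟩⟩
    · have hΔ' : Δ ∈ Set.Icc (541 / 100 : ℝ) (156 / 25 : ℝ) := ⟨hx, hΔ'.2⟩
      rcases le_total Δ (291 / 50 : ℝ) with hx | hx
      · have hΔ' : Δ ∈ Set.Icc (541 / 100 : ℝ) (291 / 50 : ℝ) := ⟨hΔ'.1, hx⟩
        rcases le_total tpd (127 / 100 : ℝ) with hx | hx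
        · have h := ndNiO2Sub_4_0 hΔ' ⟨ha.1, hx⟩ hb hc hν
          exact ⟨⟨le_trans (by norm_num) h.1.1, h.1.2.trans (by norm_num)⟩, ⟨le_trans (by norm_num) h.2.1, h.2.2.trans (by norm_num)⟩⟩
        · have h := ndNiO2Sub_4_1 hΔ' ⟨hx, ha.2⟩ hb hc hν
          exact ⟨⟨le_trans (by norm_num) h.1.1, h.1.2.trans (by norm_num)⟩, ⟨le_trans (by norm_num) h.2.1, h.2.2.trans (by norm_num)⟩⟩
      · have hΔ' : Δ ∈ Set.Icc (291 / 50 : ℝ) (156 / 25 : ℝ) := ⟨hx, hΔ'.2⟩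
        rcases le_total tpd (127 / 100 : ℝ) with hx | hx
        · have h := ndNiO2Sub_5_0 hΔ' ⟨ha.1, hx⟩ hb hc hν
          exact ⟨⟨le_trans (by norm_num) h.1.1, h.1.2.trans (by norm_num)⟩, ⟨le_trans (by norm_num) h.2.1, h.2.2.trans (by norm_num)⟩⟩
        · have h := ndNiO2Sub_5_1 hΔ' ⟨hx, ha.2⟩ hb hc hν
          exact ⟨⟨le_trans (by norm_num) h.1.1, h.1.2.trans (by norm_num)⟩, ⟨le_trans (by norm_num) h.2.1, h.2.2.trans (by norm_num)⟩⟩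

/-- **The DFT-level source row** Δ_pd ∈ [3.97, 5.0] (`ndNiO2YK26Emery_DeltaKS`) × the one-body rows, family filling: `ε ∈ [0.68, 1.54]` and `t′/t ∈ [-0.2344, -0.1748]`. [folklore] -/
theorem ndNiO2KSBox_fsRatio_window {Δ tpd tpp c ε : ℝ} (hΔ : Δ ∈ Set.Icc (397 / 100 : ℝ) (5 : ℝ))
    (ha : tpd ∈ Set.Icc (117 / 100 : ℝ) (137 / 100 : ℝ)) (hb : tpp ∈ Set.Icc (14 / 25 : ℝ) (17 / 25 : ℝ))
    (hc : c ∈ Set.Icc (121 / 1000 : ℝ) (123 / 1000 : ℝ))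
    (hν : abFilling Δ tpd tpp c ε ∈ Set.Icc (343 / 1000 : ℝ) (477 / 1000 : ℝ)) :
    ε ∈ Set.Icc (17 / 25 : ℝ) (77 / 50 : ℝ) ∧ fsRatio Δ tpd tpp c ε ∈ Set.Icc (-(293 / 1250 : ℝ)) (-(437 / 2500 : ℝ)) := by
  have hΔ' := hΔ
  rcases le_total Δ (857 / 200 : ℝ) with hx | hx
  · have hΔ' : Δ ∈ Set.Icc (397 / 100 : ℝ) (857 / 200 : ℝ) := ⟨hΔ'.1, hx⟩
    rcases le_total tpd (127 / 100 : ℝ) with hx | hx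
    · have h := ndNiO2Sub_0_0 hΔ' ⟨ha.1, hx⟩ hb hc hν
      exact ⟨⟨le_trans (by norm_num) h.1.1, h.1.2.trans (by norm_num)⟩, ⟨le_trans (by norm_num) h.2.1, h.2.2.trans (by norm_num)⟩⟩
    · have h := ndNiO2Sub_0_1 hΔ' ⟨hx, ha.2⟩ hb hc hν
      exact ⟨⟨le_trans (by norm_num) h.1.1, h.1.2.trans (by norm_num)⟩, ⟨le_trans (by norm_num) h.2.1, h.2.2.trans (by norm_num)⟩⟩
  · have hΔ' : Δ ∈ Set.Icc (857 / 200 : ℝ) (5 : ℝ) := ⟨hx, hΔ'.2⟩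
    rcases le_total Δ (23 / 5 : ℝ) with hx | hx
    · have hΔ' : Δ ∈ Set.Icc (857 / 200 : ℝ) (23 / 5 : ℝ) := ⟨hΔ'.1, hx⟩
      rcases le_total tpd (127 / 100 : ℝ) with hx | hx
      · have h := ndNiO2Sub_1_0 hΔ' ⟨ha.1, hx⟩ hb hc hν
        exact ⟨⟨le_trans (by norm_num) h.1.1, h.1.2.trans (by norm_num)⟩, ⟨le_trans (by norm_num) h.2.1, h.2.2.trans (by norm_num)⟩⟩
      · have h := ndNiO2Sub_1_1 hΔ' ⟨hx, ha.2⟩ hb hc hν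
        exact ⟨⟨le_trans (by norm_num) h.1.1, h.1.2.trans (by norm_num)⟩, ⟨le_trans (by norm_num) h.2.1, h.2.2.trans (by norm_num)⟩⟩
    · have hΔ' : Δ ∈ Set.Icc (23 / 5 : ℝ) (5 : ℝ) := ⟨hx, hΔ'.2⟩
      rcases le_total tpd (127 / 100 : ℝ) with hx | hx
      · have h := ndNiO2Sub_2_0 hΔ' ⟨ha.1, hx⟩ hb hc hν
        exact ⟨⟨le_trans (by norm_num) h.1.1, h.1.2.trans (by norm_num)⟩, ⟨le_trans (by norm_num) h.2.1, h.2.2.trans (by norm_num)⟩⟩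
      · have h := ndNiO2Sub_2_1 hΔ' ⟨hx, ha.2⟩ hb hc hν
        exact ⟨⟨le_trans (by norm_num) h.1.1, h.1.2.trans (by norm_num)⟩, ⟨le_trans (by norm_num) h.2.1, h.2.2.trans (by norm_num)⟩⟩

/-- **The bare-electron (V at mean field) image** Δ_pd ∈ [4.6, 6.24] (`ndNiO2YK26Emery_Delta`) × the one-body rows, family filling: `ε ∈ [0.56, 1.42]` and `t′/t ∈ [-0.2194, -0.1532]`. [folklore] -/
theorem ndNiO2VMFBox_fsRatio_window {Δ tpd tpp c ε : ℝ} (hΔ : Δ ∈ Set.Icc (23 / 5 : ℝ) (156 / 25 : ℝ))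
    (ha : tpd ∈ Set.Icc (117 / 100 : ℝ) (137 / 100 : ℝ)) (hb : tpp ∈ Set.Icc (14 / 25 : ℝ) (17 / 25 : ℝ))
    (hc : c ∈ Set.Icc (121 / 1000 : ℝ) (123 / 1000 : ℝ))
    (hν : abFilling Δ tpd tpp c ε ∈ Set.Icc (343 / 1000 : ℝ) (477 / 1000 : ℝ)) :
    ε ∈ Set.Icc (14 / 25 : ℝ) (71 / 50 : ℝ) ∧ fsRatio Δ tpd tpp c ε ∈ Set.Icc (-(1097 / 5000 : ℝ)) (-(383 / 2500 : ℝ)) := by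
  have hΔ' := hΔ
  rcases le_total Δ (541 / 100 : ℝ) with hx | hx
  · have hΔ' : Δ ∈ Set.Icc (23 / 5 : ℝ) (541 / 100 : ℝ) := ⟨hΔ'.1, hx⟩
    rcases le_total Δ (5 : ℝ) with hx | hx
    · have hΔ' : Δ ∈ Set.Icc (23 / 5 : ℝ) (5 : ℝ) := ⟨hΔ'.1, hx⟩
      rcases le_total tpd (127 / 100 : ℝ) with hx | hx
      · have h := ndNiO2Sub_2_0 hΔ' ⟨ha.1, hx⟩ hb hc hν
        exact ⟨⟨le_trans (by norm_num) h.1.1, h.1.2.trans (by norm_num)⟩, ⟨le_trans (by norm_num) h.2.1, h.2.2.trans (by norm_num)⟩⟩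
      · have h := ndNiO2Sub_2_1 hΔ' ⟨hx, ha.2⟩ hb hc hν
        exact ⟨⟨le_trans (by norm_num) h.1.1, h.1.2.trans (by norm_num)⟩, ⟨le_trans (by norm_num) h.2.1, h.2.2.trans (by norm_num)⟩⟩
    · have hΔ' : Δ ∈ Set.Icc (5 : ℝ) (541 / 100 : ℝ) := ⟨hx, hΔ'.2⟩
      rcases le_total tpd (127 / 100 : ℝ) with hx | hx
      · have h := ndNiO2Sub_3_0 hΔ' ⟨ha.1, hx⟩ hb hc hν
        exact ⟨⟨le_trans (by norm_num) h.1.1, h.1.2.trans (by norm_num)⟩, ⟨le_trans (by norm_num) h.2.1, h.2.2.trans (by norm_num)⟩⟩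
      · have h := ndNiO2Sub_3_1 hΔ' ⟨hx, ha.2⟩ hb hc hν
        exact ⟨⟨le_trans (by norm_num) h.1.1, h.1.2.trans (by norm_num)⟩, ⟨le_trans (by norm_num) h.2.1, h.2.2.trans (by norm_num)⟩⟩
  · have hΔ' : Δ ∈ Set.Icc (541 / 100 : ℝ) (156 / 25 : ℝ) := ⟨hx, hΔ'.2⟩
    rcases le_total Δ (291 / 50 : ℝ) with hx | hx
    · have hΔ' : Δ ∈ Set.Icc (541 / 100 : ℝ) (291 / 50 : ℝ) := ⟨hΔ'.1, hx⟩
      rcases le_total tpd (127 / 100 : ℝ) with hx | hx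
      · have h := ndNiO2Sub_4_0 hΔ' ⟨ha.1, hx⟩ hb hc hν
        exact ⟨⟨le_trans (by norm_num) h.1.1, h.1.2.trans (by norm_num)⟩, ⟨le_trans (by norm_num) h.2.1, h.2.2.trans (by norm_num)⟩⟩
      · have h := ndNiO2Sub_4_1 hΔ' ⟨hx, ha.2⟩ hb hc hν
        exact ⟨⟨le_trans (by norm_num) h.1.1, h.1.2.trans (by norm_num)⟩, ⟨le_trans (by norm_num) h.2.1, h.2.2.trans (by norm_num)⟩⟩
    · have hΔ' : Δ ∈ Set.Icc (291 / 50 : ℝ) (156 / 25 : ℝ) := ⟨hx, hΔ'.2⟩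
      rcases le_total tpd (127 / 100 : ℝ) with hx | hx
      · have h := ndNiO2Sub_5_0 hΔ' ⟨ha.1, hx⟩ hb hc hν
        exact ⟨⟨le_trans (by norm_num) h.1.1, h.1.2.trans (by norm_num)⟩, ⟨le_trans (by norm_num) h.2.1, h.2.2.trans (by norm_num)⟩⟩
      · have h := ndNiO2Sub_5_1 hΔ' ⟨hx, ha.2⟩ hb hc hν
        exact ⟨⟨le_trans (by norm_num) h.1.1, h.1.2.trans (by norm_num)⟩, ⟨le_trans (by norm_num) h.2.1, h.2.2.trans (by norm_num)⟩⟩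

/-- **MODEL-FORM GAP (raw).** On the whole hull and at every family filling the σ-model Fermi-surface ratio exceeds the UPPER end `−9/25` of
the object-E row of record by at least `1/8`: `−9/25 + 1/8 ≤ t′/t`. [folklore] -/
theorem ndNiO2HullBox_fsRatio_gap_objectE {Δ tpd tpp c ε : ℝ} (hΔ : Δ ∈ Set.Icc (397 / 100 : ℝ) (156 / 25 : ℝ))
    (ha : tpd ∈ Set.Icc (117 / 100 : ℝ) (137 / 100 : ℝ)) (hb : tpp ∈ Set.Icc (14 / 25 : ℝ) (17 / 25 : ℝ))
    (hc : c ∈ Set.Icc (121 / 1000 : ℝ) (123 / 1000 : ℝ))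
    (hν : abFilling Δ tpd tpp c ε ∈ Set.Icc (343 / 1000 : ℝ) (477 / 1000 : ℝ)) :
    -(9 / 25 : ℝ) + 1 / 8 ≤ fsRatio Δ tpd tpp c ε := by
  have h := (ndNiO2HullBox_fsRatio_window hΔ ha hb hc hν).2.1
  have h18 : -(9 / 25 : ℝ) + 1 / 8 ≤ (-(293 / 1250 : ℝ)) := by norm_num
  exact h18.trans h

/-- **… hence the σ three-band model of the #21 rows never produces an object-E Fermi surface**: `t′/t ∉ [−23/50, −9/25]` (the typed row
`ndNiO2E_M21_tp`, identical in the M22/M59/M60 columns) at any box point and any family filling. [folklore] -/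
theorem ndNiO2HullBox_fsRatio_not_objectE {Δ tpd tpp c ε : ℝ} (hΔ : Δ ∈ Set.Icc (397 / 100 : ℝ) (156 / 25 : ℝ))
    (ha : tpd ∈ Set.Icc (117 / 100 : ℝ) (137 / 100 : ℝ)) (hb : tpp ∈ Set.Icc (14 / 25 : ℝ) (17 / 25 : ℝ))
    (hc : c ∈ Set.Icc (121 / 1000 : ℝ) (123 / 1000 : ℝ))
    (hν : abFilling Δ tpd tpp c ε ∈ Set.Icc (343 / 1000 : ℝ) (477 / 1000 : ℝ)) :
    fsRatio Δ tpd tpp c ε ∉ Set.Icc (-(23 / 50 : ℝ)) (-(9 / 25 : ℝ)) := by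
  intro hmem
  have h := ndNiO2HullBox_fsRatio_gap_objectE hΔ ha hb hc hν
  linarith [hmem.2]

/-- **READING 2 (raw)**: `|t′/t| < 1/4` for the σ model on the whole hull at every family filling — inside hubbard-fast's one-band domain
𝒟 (`|t′/t| ≤ 3/10`), unlike object E. [folklore] -/
theorem ndNiO2HullBox_abs_fsRatio_lt_quarter {Δ tpd tpp c ε : ℝ} (hΔ : Δ ∈ Set.Icc (397 / 100 : ℝ) (156 / 25 : ℝ))
    (ha : tpd ∈ Set.Icc (117 / 100 : ℝ) (137 / 100 : ℝ)) (hb : tpp ∈ Set.Icc (14 / 25 : ℝ) (17 / 25 : ℝ))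
    (hc : c ∈ Set.Icc (121 / 1000 : ℝ) (123 / 1000 : ℝ))
    (hν : abFilling Δ tpd tpp c ε ∈ Set.Icc (343 / 1000 : ℝ) (477 / 1000 : ℝ)) :
    |fsRatio Δ tpd tpp c ε| < 1 / 4 := by
  have h := (ndNiO2HullBox_fsRatio_window hΔ ha hb hc hν).2
  rw [abs_lt]
  constructor
  · have : -(1 / 4 : ℝ) < (-(293 / 1250 : ℝ)) := by norm_num
    linarith [h.1]
  · have : (-(383 / 2500 : ℝ)) < (1 / 4 : ℝ) := by norm_num
    linarith [h.2]

/-! ## §2 The typed 3BE objects of #21: one-body rows unfolded, and the words -/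

/-- The four one-body rows of the #21 SOURCE box `emeryBoxNdNiO2YK26Src` (Δ_pd = the DFT-level row [3.97, 5.0]), unfolded. [folklore] -/
theorem emeryBoxNdNiO2YK26Src_oneBody {p : EmeryCoord → ℝ} (hp : emeryBoxNdNiO2YK26Src.Mem p) :
    p .DeltaPd ∈ Set.Icc (397 / 100 : ℝ) (5 : ℝ) ∧ p .tpd ∈ Set.Icc (117 / 100 : ℝ) (137 / 100 : ℝ) ∧
      p .tpp ∈ Set.Icc (14 / 25 : ℝ) (17 / 25 : ℝ) ∧ p .tppP ∈ Set.Icc (121 / 1000 : ℝ) (123 / 1000 : ℝ) := by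
  have h0 := (Entry.mem_ofEnds_iff _ _ _ _ _).1 (hp .DeltaPd ndNiO2YK26Emery_DeltaKS rfl)
  have h1 := (Entry.mem_ofEnds_iff _ _ _ _ _).1 (hp .tpd ndNiO2YK26Emery_tpd rfl)
  have h2 := (Entry.mem_ofEnds_iff _ _ _ _ _).1 (hp .tpp ndNiO2YK26Emery_tpp rfl)
  have h3 := (Entry.mem_ofEnds_iff _ _ _ _ _).1 (hp .tppP ndNiO2YK26Emery_tppP rfl)
  push_cast at h0 h1 h2 h3
  exact ⟨⟨h0.1, h0.2⟩, ⟨h1.1, h1.2⟩, ⟨h2.1, h2.2⟩, ⟨h3.1, h3.2⟩⟩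

/-- The U-slice of record reads its `t_pp′` row from the source box (`Function.update` touches `Delta_pd` only). [folklore] -/
theorem emeryBoxNdNiO2YK26_tppP_entry : emeryBoxNdNiO2YK26 .tppP = some ndNiO2YK26Emery_tppP := by
  simp [emeryBoxNdNiO2YK26, emeryBoxNdNiO2YK26Src, Function.update]

/-- The four one-body rows of the U-SLICE OF RECORD `emeryBoxNdNiO2YK26` (Δ_pd = the bare-electron image [4.6, 6.24]), unfolded. [folklore] -/
theorem emeryBoxNdNiO2YK26_oneBody {p : EmeryCoord → ℝ} (hp : emeryBoxNdNiO2YK26.Mem p) :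
    p .DeltaPd ∈ Set.Icc (23 / 5 : ℝ) (156 / 25 : ℝ) ∧ p .tpd ∈ Set.Icc (117 / 100 : ℝ) (137 / 100 : ℝ) ∧
      p .tpp ∈ Set.Icc (14 / 25 : ℝ) (17 / 25 : ℝ) ∧ p .tppP ∈ Set.Icc (121 / 1000 : ℝ) (123 / 1000 : ℝ) := by
  have h0 := (Entry.mem_ofEnds_iff _ _ _ _ _).1 (hp .DeltaPd ndNiO2YK26Emery_Delta emeryBoxNdNiO2YK26_entries.2.2.1)
  have h1 := (Entry.mem_ofEnds_iff _ _ _ _ _).1 (hp .tpd ndNiO2YK26Emery_tpd emeryBoxNdNiO2YK26_entries.1)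
  have h2 := (Entry.mem_ofEnds_iff _ _ _ _ _).1 (hp .tpp ndNiO2YK26Emery_tpp emeryBoxNdNiO2YK26_entries.2.1)
  have h3 := (Entry.mem_ofEnds_iff _ _ _ _ _).1 (hp .tppP ndNiO2YK26Emery_tppP emeryBoxNdNiO2YK26_tppP_entry)
  push_cast at h0 h1 h2 h3
  exact ⟨⟨h0.1, h0.2⟩, ⟨h1.1, h1.2⟩, ⟨h2.1, h2.2⟩, ⟨h3.1, h3.2⟩⟩

/-- **THE WORD ON THE TYPED SOURCE OBJECT `emeryBoxNdNiO2YK26Src`** (#21 NdNiO₂, DFT-level one-body rows Δ_pd [3.97, 5.0] × t_pd × t_pp × t_pp′):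
at every parameter vector and every Fermi energy whose antibonding-band filling lies in the family band [0.343, 0.477] the exact Fermi-surface
`t′/t` of the σ three-band model lies in `[-0.2344, -0.1748]`. [cite: HybertsenSchluterChristensen1989, Eq. (1) (three-band d–p model)] -/
theorem emeryBoxNdNiO2YK26Src_fsRatio_window :
    HoldsOn (fun p : EmeryCoord → ℝ => ∀ ε : ℝ,
      abFilling (p .DeltaPd) (p .tpd) (p .tpp) (p .tppP) ε ∈ Set.Icc (343 / 1000 : ℝ) (477 / 1000 : ℝ) →
      fsRatio (p .DeltaPd) (p .tpd) (p .tpp) (p .tppP) ε ∈ Set.Icc (-(293 / 1250 : ℝ)) (-(437 / 2500 : ℝ))) emeryBoxNdNiO2YK26Src := by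
  intro p hp ε hν
  obtain ⟨hΔ, ha, hb, hc⟩ := emeryBoxNdNiO2YK26Src_oneBody hp
  exact (ndNiO2KSBox_fsRatio_window hΔ ha hb hc hν).2

/-- **The Fermi-energy bracket on the typed source object**: ε_F ∈ [0.68, 1.54] eV above ε_d at any family filling. [folklore] -/
theorem emeryBoxNdNiO2YK26Src_fermiEnergy_bracket :
    HoldsOn (fun p : EmeryCoord → ℝ => ∀ ε : ℝ,
      abFilling (p .DeltaPd) (p .tpd) (p .tpp) (p .tppP) ε ∈ Set.Icc (343 / 1000 : ℝ) (477 / 1000 : ℝ) →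
      ε ∈ Set.Icc (17 / 25 : ℝ) (77 / 50 : ℝ)) emeryBoxNdNiO2YK26Src := by
  intro p hp ε hν
  obtain ⟨hΔ, ha, hb, hc⟩ := emeryBoxNdNiO2YK26Src_oneBody hp
  exact (ndNiO2KSBox_fsRatio_window hΔ ha hb hc hν).1

/-- **THE WORD ON THE U-SLICE OF RECORD `emeryBoxNdNiO2YK26`** (Δ_pd = bare-electron image [4.6, 6.24]): `t′/t ∈ [-0.2194, -0.1532]` at any
family filling. [cite: HybertsenSchluterChristensen1989, Eq. (1) (three-band d–p model)] -/
theorem emeryBoxNdNiO2YK26_fsRatio_window :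
    HoldsOn (fun p : EmeryCoord → ℝ => ∀ ε : ℝ,
      abFilling (p .DeltaPd) (p .tpd) (p .tpp) (p .tppP) ε ∈ Set.Icc (343 / 1000 : ℝ) (477 / 1000 : ℝ) →
      fsRatio (p .DeltaPd) (p .tpd) (p .tpp) (p .tppP) ε ∈ Set.Icc (-(1097 / 5000 : ℝ)) (-(383 / 2500 : ℝ))) emeryBoxNdNiO2YK26 := by
  intro p hp ε hν
  obtain ⟨hΔ, ha, hb, hc⟩ := emeryBoxNdNiO2YK26_oneBody hp
  exact (ndNiO2VMFBox_fsRatio_window hΔ ha hb hc hν).2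

/-- The same word on the RE-ISSUED narrower-Δ variant `emeryBoxNdNiO2Dxy459YK26` (⊑ the U-slice of record; `EmeryBoxesKSlicesT`). [folklore] -/
theorem emeryBoxNdNiO2Dxy459YK26_fsRatio_window :
    HoldsOn (fun p : EmeryCoord → ℝ => ∀ ε : ℝ,
      abFilling (p .DeltaPd) (p .tpd) (p .tpp) (p .tppP) ε ∈ Set.Icc (343 / 1000 : ℝ) (477 / 1000 : ℝ) →
      fsRatio (p .DeltaPd) (p .tpd) (p .tpp) (p .tppP) ε ∈ Set.Icc (-(1097 / 5000 : ℝ)) (-(383 / 2500 : ℝ))) emeryBoxNdNiO2Dxy459YK26 :=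
  holdsOn_emeryBoxNdNiO2Dxy459YK26_of emeryBoxNdNiO2YK26_fsRatio_window

/-- … and on the R-mg (f) variant `emeryBoxNdNiO2Dxy45YK26` (⊑ the re-issued one; `EmeryBoxesKSlicesR/T`). [folklore] -/
theorem emeryBoxNdNiO2Dxy45YK26_fsRatio_window :
    HoldsOn (fun p : EmeryCoord → ℝ => ∀ ε : ℝ,
      abFilling (p .DeltaPd) (p .tpd) (p .tpp) (p .tppP) ε ∈ Set.Icc (343 / 1000 : ℝ) (477 / 1000 : ℝ) →
      fsRatio (p .DeltaPd) (p .tpd) (p .tpp) (p .tppP) ε ∈ Set.Icc (-(1097 / 5000 : ℝ)) (-(383 / 2500 : ℝ))) emeryBoxNdNiO2Dxy45YK26 :=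
  holdsOn_emeryBoxNdNiO2Dxy45YK26_of_Dxy459 emeryBoxNdNiO2Dxy459YK26_fsRatio_window

/-! ## §3 The two-box words: σ image of the 3BE rows vs the typed object-E boxes of box #20 -/

/-- **TWO-BOX WORD (column M21, NdNiO₂ parent film).** For every member of the #21 3BE source object `emeryBoxNdNiO2YK26Src` and every member `q` of the typed
object-E box `boxNdNiO2E_M21` (`BoxesNdNiO2E`: tp/t_eff ∈ [−0.46, −0.36], n ∈ [0.852, 0.954]), at any σ-model Fermi energy carrying `q`'s own electron density
(`abFilling = q.filling/2`): the σ-model Fermi-surface `t′/t` exceeds `q`'s by at least `1/8`. [folklore] -/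
theorem emeryBoxNdNiO2YK26Src_fsRatio_gap_boxNdNiO2E_M21 :
    HoldsOn (fun p : EmeryCoord → ℝ => ∀ q : OneBandCoord → ℝ, boxNdNiO2E_M21.Mem q → ∀ ε : ℝ,
      abFilling (p .DeltaPd) (p .tpd) (p .tpp) (p .tppP) ε = q .filling / 2 →
      q .tpOverT + 1 / 8 ≤ fsRatio (p .DeltaPd) (p .tpd) (p .tpp) (p .tppP) ε) emeryBoxNdNiO2YK26Src := by
  intro p hp q hq ε hfill
  obtain ⟨hΔ, ha, hb, hc⟩ := emeryBoxNdNiO2YK26Src_oneBody hp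
  obtain ⟨-, -, h3, h4, h5, h6, -⟩ := (boxNdNiO2E_M21_mem_iff q).1 hq
  push_cast at h3 h4 h5 h6
  have hν : abFilling (p .DeltaPd) (p .tpd) (p .tpp) (p .tppP) ε ∈ Set.Icc (343 / 1000 : ℝ) (477 / 1000 : ℝ) := by
    rw [hfill]; constructor <;> linarith
  have hΔh : p .DeltaPd ∈ Set.Icc (397 / 100 : ℝ) (156 / 25 : ℝ) := ⟨hΔ.1, hΔ.2.trans (by norm_num)⟩
  have h := ndNiO2HullBox_fsRatio_gap_objectE hΔh ha hb hc hν
  linarith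

/-- **TWO-BOX WORD (column M22, Nd₀.₈Sr₀.₂NiO₂).** For every member of the #21 3BE source object `emeryBoxNdNiO2YK26Src` and every member `q` of the typed
object-E box `boxNdSrNiO2E_M22` (`BoxesNdNiO2E`: tp/t_eff ∈ [−0.46, −0.36], n ∈ [0.718, 0.818]), at any σ-model Fermi energy carrying `q`'s own electron density
(`abFilling = q.filling/2`): the σ-model Fermi-surface `t′/t` exceeds `q`'s by at least `1/8`. [folklore] -/
theorem emeryBoxNdNiO2YK26Src_fsRatio_gap_boxNdSrNiO2E_M22 :
    HoldsOn (fun p : EmeryCoord → ℝ => ∀ q : OneBandCoord → ℝ, boxNdSrNiO2E_M22.Mem q → ∀ ε : ℝ,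
      abFilling (p .DeltaPd) (p .tpd) (p .tpp) (p .tppP) ε = q .filling / 2 →
      q .tpOverT + 1 / 8 ≤ fsRatio (p .DeltaPd) (p .tpd) (p .tpp) (p .tppP) ε) emeryBoxNdNiO2YK26Src := by
  intro p hp q hq ε hfill
  obtain ⟨hΔ, ha, hb, hc⟩ := emeryBoxNdNiO2YK26Src_oneBody hp
  obtain ⟨-, -, h3, h4, h5, h6, -⟩ := (boxNdSrNiO2E_M22_mem_iff q).1 hq
  push_cast at h3 h4 h5 h6
  have hν : abFilling (p .DeltaPd) (p .tpd) (p .tpp) (p .tppP) ε ∈ Set.Icc (343 / 1000 : ℝ) (477 / 1000 : ℝ) := by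
    rw [hfill]; constructor <;> linarith
  have hΔh : p .DeltaPd ∈ Set.Icc (397 / 100 : ℝ) (156 / 25 : ℝ) := ⟨hΔ.1, hΔ.2.trans (by norm_num)⟩
  have h := ndNiO2HullBox_fsRatio_gap_objectE hΔh ha hb hc hν
  linarith

/-- **TWO-BOX WORD (column M59, Nd₀.₉Sr₀.₁NiO₂).** For every member of the #21 3BE source object `emeryBoxNdNiO2YK26Src` and every member `q` of the typed
object-E box `boxNdSrNiO2E_M59` (`BoxesNdNiO2E`: tp/t_eff ∈ [−0.46, −0.36], n ∈ [0.79, 0.89]), at any σ-model Fermi energy carrying `q`'s own electron density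
(`abFilling = q.filling/2`): the σ-model Fermi-surface `t′/t` exceeds `q`'s by at least `1/8`. [folklore] -/
theorem emeryBoxNdNiO2YK26Src_fsRatio_gap_boxNdSrNiO2E_M59 :
    HoldsOn (fun p : EmeryCoord → ℝ => ∀ q : OneBandCoord → ℝ, boxNdSrNiO2E_M59.Mem q → ∀ ε : ℝ,
      abFilling (p .DeltaPd) (p .tpd) (p .tpp) (p .tppP) ε = q .filling / 2 →
      q .tpOverT + 1 / 8 ≤ fsRatio (p .DeltaPd) (p .tpd) (p .tpp) (p .tppP) ε) emeryBoxNdNiO2YK26Src := by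
  intro p hp q hq ε hfill
  obtain ⟨hΔ, ha, hb, hc⟩ := emeryBoxNdNiO2YK26Src_oneBody hp
  obtain ⟨-, -, h3, h4, h5, h6, -⟩ := (boxNdSrNiO2E_M59_mem_iff q).1 hq
  push_cast at h3 h4 h5 h6
  have hν : abFilling (p .DeltaPd) (p .tpd) (p .tpp) (p .tppP) ε ∈ Set.Icc (343 / 1000 : ℝ) (477 / 1000 : ℝ) := by
    rw [hfill]; constructor <;> linarith
  have hΔh : p .DeltaPd ∈ Set.Icc (397 / 100 : ℝ) (156 / 25 : ℝ) := ⟨hΔ.1, hΔ.2.trans (by norm_num)⟩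
  have h := ndNiO2HullBox_fsRatio_gap_objectE hΔh ha hb hc hν
  linarith

/-- **TWO-BOX WORD (column M60, Nd₀.₇₅Sr₀.₂₅NiO₂).** For every member of the #21 3BE source object `emeryBoxNdNiO2YK26Src` and every member `q` of the typed
object-E box `boxNdSrNiO2E_M60` (`BoxesNdNiO2E`: tp/t_eff ∈ [−0.46, −0.36], n ∈ [0.686, 0.786]), at any σ-model Fermi energy carrying `q`'s own electron density
(`abFilling = q.filling/2`): the σ-model Fermi-surface `t′/t` exceeds `q`'s by at least `1/8`. [folklore] -/
theorem emeryBoxNdNiO2YK26Src_fsRatio_gap_boxNdSrNiO2E_M60 :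
    HoldsOn (fun p : EmeryCoord → ℝ => ∀ q : OneBandCoord → ℝ, boxNdSrNiO2E_M60.Mem q → ∀ ε : ℝ,
      abFilling (p .DeltaPd) (p .tpd) (p .tpp) (p .tppP) ε = q .filling / 2 →
      q .tpOverT + 1 / 8 ≤ fsRatio (p .DeltaPd) (p .tpd) (p .tpp) (p .tppP) ε) emeryBoxNdNiO2YK26Src := by
  intro p hp q hq ε hfill
  obtain ⟨hΔ, ha, hb, hc⟩ := emeryBoxNdNiO2YK26Src_oneBody hp
  obtain ⟨-, -, h3, h4, h5, h6, -⟩ := (boxNdSrNiO2E_M60_mem_iff q).1 hq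
  push_cast at h3 h4 h5 h6
  have hν : abFilling (p .DeltaPd) (p .tpd) (p .tpp) (p .tppP) ε ∈ Set.Icc (343 / 1000 : ℝ) (477 / 1000 : ℝ) := by
    rw [hfill]; constructor <;> linarith
  have hΔh : p .DeltaPd ∈ Set.Icc (397 / 100 : ℝ) (156 / 25 : ℝ) := ⟨hΔ.1, hΔ.2.trans (by norm_num)⟩
  have h := ndNiO2HullBox_fsRatio_gap_objectE hΔh ha hb hc hν
  linarith

/-- **The same two-box word for the U-SLICE OF RECORD `emeryBoxNdNiO2YK26`** (bare-electron Δ image) against `boxNdNiO2E_M21`. [folklore] -/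
theorem emeryBoxNdNiO2YK26_fsRatio_gap_boxNdNiO2E_M21 :
    HoldsOn (fun p : EmeryCoord → ℝ => ∀ q : OneBandCoord → ℝ, boxNdNiO2E_M21.Mem q → ∀ ε : ℝ,
      abFilling (p .DeltaPd) (p .tpd) (p .tpp) (p .tppP) ε = q .filling / 2 →
      q .tpOverT + 1 / 8 ≤ fsRatio (p .DeltaPd) (p .tpd) (p .tpp) (p .tppP) ε) emeryBoxNdNiO2YK26 := by
  intro p hp q hq ε hfill
  obtain ⟨hΔ, ha, hb, hc⟩ := emeryBoxNdNiO2YK26_oneBody hp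
  obtain ⟨-, -, h3, h4, h5, h6, -⟩ := (boxNdNiO2E_M21_mem_iff q).1 hq
  push_cast at h3 h4 h5 h6
  have hν : abFilling (p .DeltaPd) (p .tpd) (p .tpp) (p .tppP) ε ∈ Set.Icc (343 / 1000 : ℝ) (477 / 1000 : ℝ) := by
    rw [hfill]; constructor <;> linarith
  have hΔh : p .DeltaPd ∈ Set.Icc (397 / 100 : ℝ) (156 / 25 : ℝ) := ⟨le_trans (by norm_num) hΔ.1, hΔ.2⟩
  have h := ndNiO2HullBox_fsRatio_gap_objectE hΔh ha hb hc hν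
  linarith

/-- … transferred down the typed chain to `emeryBoxNdNiO2Dxy459YK26` and `emeryBoxNdNiO2Dxy45YK26`. [folklore] -/
theorem emeryBoxNdNiO2Dxy45YK26_fsRatio_gap_boxNdNiO2E_M21 :
    HoldsOn (fun p : EmeryCoord → ℝ => ∀ q : OneBandCoord → ℝ, boxNdNiO2E_M21.Mem q → ∀ ε : ℝ,
      abFilling (p .DeltaPd) (p .tpd) (p .tpp) (p .tppP) ε = q .filling / 2 →
      q .tpOverT + 1 / 8 ≤ fsRatio (p .DeltaPd) (p .tpd) (p .tpp) (p .tppP) ε) emeryBoxNdNiO2Dxy45YK26 :=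
  holdsOn_emeryBoxNdNiO2Dxy45YK26_of_Dxy459 (holdsOn_emeryBoxNdNiO2Dxy459YK26_of emeryBoxNdNiO2YK26_fsRatio_gap_boxNdNiO2E_M21)

end Summit.Ventures.CertifiedManyBodySolver.Downfold.Emery
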